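import Mathlib.MeasureTheory.Function.L2Space
import Literature.Analysis.FluidPDE.MVWeakStrongDefs
import HarnessLib

/-!
# Integrability of the relative-energy integrands against a dissipative measure-valued solution

For a dissipative measure-valued solution `(Y, D)` (`DissipativeMVEuler.IsDissipativeMVSolution`)
carried by the open quadrant and a classical solution on `[0,T₁) ⊃ [0,T]`, the moment bound (2.8)–(2.11)
(field `moment_bound`) makes every integrand of the relative-energy argument integrable:

* `integrable_basic_of_moment` — on one fibre `Y z`: `ρ, m, ½|m|²/ρ, E, p(ρ,E), mᵢmⱼ/ρ, ρZ(s), Z(s)m`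
  and the moment function are integrable as soon as `∫⁻ momentFun dY z < ∞`;
* `ae_moment_lt_top` — this finiteness holds for a.e. `z ∈ (0,T) × 𝕋³` (product measure) and, at
  a.e. time, for a.e. `x`;
* `slice_integrable` / `spacetime_integrable` — for the integrands `g ∈ {contI, momI, entI, relEnergyZ,
  rawRHS, relEnergyFull-type}` built from the point data: `w ↦ g` is `Y(τ,x)`-integrable for a.e. `x` and
  `x ↦ ⟨Y_{τ,x}; g⟩` is integrable (at every time `τ ∈ (0,T₁)` where the slice moment bound holds), and
  `z ↦ ⟨Y_z; g⟩` is integrable on `(0,T) × 𝕋³`.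

## References

* J. Březina, E. Feireisl, J. Math. Soc. Japan 70 (2018), Def. 2.9, §3.1.1.
-/

noncomputable section

open Set Function MeasureTheory ProbabilityTheory Filter
open scoped BigOperators ENNReal Topology InnerProductSpace

namespace Literature.Analysis.FluidPDE

namespace CompressibleEuler

open Literature.Analysis.FunctionSpaces Literature.Analysis.FunctionSpaces.Torus EulerPhase
  StrongPointData EulerEOS

variable {eos : EulerEOS}

/-! ## Integrability on one fibre -/

/-- **Basic integrability on a fibre.** For a finite measure `μ` on the phase space carried by the
open quadrant with `∫⁻ momentFun dμ < ∞`: `ρ, m, mᵢ, ½|m|²/ρ, E, p(ρ,E), mᵢmⱼ/ρ, ρ Z(s(ρ,E)),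
Z(s(ρ,E)) m` and `momentFun` are `μ`-integrable (`|Z| ≤ Zb`, `Z` continuous). [folklore] -/
theorem integrable_basic_of_moment (hG : eos.IsGibbs) (hS : eos.IsThermodynamicallyStable)
    (htemp : ∀ r E : ℝ, 0 < r → 0 < E →
      0 < eos.temperature r E ∧ r * eos.e r (eos.temperature r E) = E)
    {μ : Measure EulerPhase} [IsFiniteMeasure μ] (hμ : ∀ᵐ w ∂μ, w ∈ phaseQuadrant)
    (hfin : ∫⁻ w, ENNReal.ofReal (momentFun eos.toConservative w) ∂μ ≠ ∞)
    {Z : ℝ → ℝ} (hZc : Continuous Z) {Zb : ℝ} (hZb : ∀ x, |Z x| ≤ Zb) :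
    Integrable (momentFun eos.toConservative) μ ∧
    Integrable (dens : EulerPhase → ℝ) μ ∧ Integrable (mom : EulerPhase → EuclideanSpace ℝ (Fin 3)) μ ∧
    (∀ i, Integrable (fun w : EulerPhase => mom w i) μ) ∧
    Integrable (kineticEnergy : EulerPhase → ℝ) μ ∧ Integrable (ien : EulerPhase → ℝ) μ ∧
    Integrable (fun w : EulerPhase => eos.p (dens w) (stateTemp eos (dens w) (ien w))) μ ∧
    (∀ i j, Integrable (fun w : EulerPhase => mom w i * mom w j / dens w) μ) ∧
    Integrable (fun w : EulerPhase => dens w * Z (eos.s (dens w) (stateTemp eos (dens w) (ien w)))) μ ∧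
    Integrable (fun w : EulerPhase =>
      Z (eos.s (dens w) (stateTemp eos (dens w) (ien w))) • mom w) μ := by
  set Φ := momentFun eos.toConservative with hΦdef
  have hZb0 : 0 ≤ Zb := (abs_nonneg _).trans (hZb 0)
  -- the moment function itself
  have hΦm : AEStronglyMeasurable Φ μ :=
    aestronglyMeasurable_of_continuousOn_of_ae_mem (continuousOn_momentFun hG hS htemp)
      measurableSet_phaseQuadrant hμ
  have hΦnn : 0 ≤ᵐ[μ] Φ := hμ.mono fun w hw => momentFun_nonneg hw
  have hΦ : Integrable Φ μ := by
    refine ⟨hΦm, ?_⟩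
    rw [hasFiniteIntegral_iff_enorm]
    have : ∫⁻ w, ‖Φ w‖ₑ ∂μ = ∫⁻ w, ENNReal.ofReal (Φ w) ∂μ :=
      lintegral_congr_ae (hΦnn.mono fun w hw => by beta_reduce; rw [Real.enorm_eq_ofReal hw])
    rw [this]; exact hfin.lt_top
  -- a domination principle
  have dom : ∀ {f : EulerPhase → ℝ} (k : ℝ), AEStronglyMeasurable f μ →
      (∀ w ∈ phaseQuadrant, |f w| ≤ k * Φ w) → Integrable f μ := by
    intro f k hf hb
    refine Integrable.mono' (hΦ.const_mul k) hf (hμ.mono fun w hw => ?_)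
    rw [Real.norm_eq_abs]; exact hb w hw
  have aesm : ∀ {f : EulerPhase → ℝ}, ContinuousOn f phaseQuadrant → AEStronglyMeasurable f μ :=
    fun hf => aestronglyMeasurable_of_continuousOn_of_ae_mem hf measurableSet_phaseQuadrant hμ
  have wS := continuousOn_stateEntropy hG hS htemp
  have wP := continuousOn_statePressure hG hS htemp
  have wZS : ContinuousOn (fun w : EulerPhase => Z (eos.s (dens w) (stateTemp eos (dens w) (ien w))))
      phaseQuadrant := hZc.comp_continuousOn wS
  have wM : ∀ i, Continuous fun w : EulerPhase => mom w i := fun i =>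
    (EuclideanSpace.proj i : EuclideanSpace ℝ (Fin 3) →L[ℝ] ℝ).continuous.comp continuous_mom
  -- the scalar fields
  have hdens : Integrable (dens : EulerPhase → ℝ) μ :=
    dom 1 continuous_dens.aestronglyMeasurable fun w hw => by
      rw [abs_of_pos hw.1, one_mul]; exact dens_le_momentFun hw
  have hmi : ∀ i, Integrable (fun w : EulerPhase => mom w i) μ := fun i =>
    dom 1 (wM i).aestronglyMeasurable fun w hw => by
      rw [one_mul]; exact abs_mom_apply_le_momentFun hw i
  have hmom : Integrable (mom : EulerPhase → EuclideanSpace ℝ (Fin 3)) μ := by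
    refine Integrable.mono' hΦ continuous_mom.aestronglyMeasurable (hμ.mono fun w hw => ?_)
    exact norm_mom_le_momentFun hw
  have hkin : Integrable (kineticEnergy : EulerPhase → ℝ) μ :=
    dom 1 (aesm continuousOn_kineticEnergy) fun w hw => by
      rw [abs_of_nonneg (kineticEnergy_nonneg hw.1.le), one_mul]; exact kineticEnergy_le_momentFun hw
  have hien : Integrable (ien : EulerPhase → ℝ) μ :=
    dom 1 continuous_ien.aestronglyMeasurable fun w hw => by
      rw [abs_of_pos hw.2, one_mul]; exact ien_le_momentFun hw
  have hp : Integrable (fun w : EulerPhase => eos.p (dens w) (stateTemp eos (dens w) (ien w))) μ :=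
    dom 1 (aesm wP) fun w hw => by
      rw [one_mul]; exact abs_pressure_le_momentFun (ceos := eos.toConservative) hw
  have hmm : ∀ i j, Integrable (fun w : EulerPhase => mom w i * mom w j / dens w) μ := by
    intro i j
    refine dom 6 (aesm ?_) fun w hw => ?_
    · exact ((wM i).continuousOn.mul (wM j).continuousOn).div continuous_dens.continuousOn
        fun w hw => (hw.1).ne'
    · have h1 : |mom w i * mom w j / dens w| ≤ ∑ i, ∑ j, |mom w i * mom w j / dens w| := by
        refine le_trans ?_ (Finset.single_le_sum (f := fun i => ∑ j, |mom w i * mom w j / dens w|)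
          (fun i _ => Finset.sum_nonneg fun j _ => abs_nonneg _) (Finset.mem_univ i))
        exact Finset.single_le_sum (f := fun j => |mom w i * mom w j / dens w|)
          (fun j _ => abs_nonneg _) (Finset.mem_univ j)
      exact h1.trans ((sum_sum_abs_mom_mul_div_le hw).trans
        (mul_le_mul_of_nonneg_left (kineticEnergy_le_momentFun hw) (by norm_num)))
  have hρZ : Integrable (fun w : EulerPhase => dens w * Z (eos.s (dens w) (stateTemp eos (dens w) (ien w)))) μ :=
    dom Zb (aesm (continuous_dens.continuousOn.mul wZS)) fun w hw => by
      rw [abs_mul, abs_of_pos hw.1, mul_comm]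
      exact mul_le_mul (hZb _) (dens_le_momentFun hw) hw.1.le hZb0
  have hZm : Integrable (fun w : EulerPhase =>
      Z (eos.s (dens w) (stateTemp eos (dens w) (ien w))) • mom w) μ := by
    refine Integrable.mono' (hΦ.const_mul Zb) ?_ (hμ.mono fun w hw => ?_)
    · exact aestronglyMeasurable_iff_aemeasurable.2 <|
        ((aesm wZS).aemeasurable.smul continuous_mom.aemeasurable)
    · rw [norm_smul, Real.norm_eq_abs]
      exact mul_le_mul (hZb _) (norm_mom_le_momentFun hw) (norm_nonneg _) hZb0
  exact ⟨hΦ, hdens, hmom, hmi, hkin, hien, hp, hmm, hρZ, hZm⟩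

/-! ## Finiteness of the moment for a.e. fibre -/

variable {T : ℝ} {Y : Kernel (ℝ × UnitAddTorus (Fin 3)) EulerPhase} {D : ℝ → ℝ}

/-- **The moment is finite on a.e. fibre of `(0,T) × 𝕋³`** (field `moment_bound`, Tonelli).
[cite: BrezinaFeireisl2018, (2.8)–(2.11)] -/
theorem ae_moment_lt_top (hG : eos.IsGibbs) (hS : eos.IsThermodynamicallyStable)
    (htemp : ∀ r E : ℝ, 0 < r → 0 < E →
      0 < eos.temperature r E ∧ r * eos.e r (eos.temperature r E) = E)
    (hMV : IsDissipativeMVSolution eos.toConservative T Y D)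
    (hsupp : ∀ z, ∀ᵐ w ∂(Y z), w ∈ phaseQuadrant) :
    ∀ᵐ z ∂((volume : Measure (ℝ × UnitAddTorus (Fin 3))).restrict (Ioo 0 T ×ˢ univ)),
      ∫⁻ w, ENNReal.ofReal (momentFun eos.toConservative w) ∂(Y z) < ∞ := by
  obtain ⟨C, hC, hbound⟩ := hMV.moment_bound
  have hmeas : Measurable fun z => ∫⁻ w, ENNReal.ofReal (momentFun' eos w) ∂(Y z) :=
    ((measurable_momentFun' hG hS htemp).ennreal_ofReal).lintegral_kernel
  have h : ∀ᵐ z ∂((volume.restrict (Ioo (0 : ℝ) T)).prod (volume : Measure (UnitAddTorus (Fin 3)))),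
      ∫⁻ w, ENNReal.ofReal (momentFun' eos w) ∂(Y z) < ∞ := by
    refine ae_restrict_prod_lt_top hmeas ?_
    filter_upwards [hbound] with τ hτ
    refine ne_of_lt (lt_of_le_of_lt (le_of_eq_of_le ?_ hτ) hC)
    exact lintegral_congr fun x => lintegral_momentFun'_eq (hsupp (τ, x))
  rw [Measure.restrict_prod_eq_prod_univ] at h
  change ∀ᵐ z ∂((volume.prod volume : Measure (ℝ × UnitAddTorus (Fin 3))).restrict (Ioo 0 T ×ˢ univ)), _ at h
  filter_upwards [h] with z hz
  rwa [lintegral_momentFun'_eq (hsupp z)] at hz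

/-- At a time where the slice moment bound holds, the moment is finite on a.e. fibre `Y(τ, x)`.
[folklore] -/
theorem ae_slice_moment_lt_top (hG : eos.IsGibbs) (hS : eos.IsThermodynamicallyStable)
    (htemp : ∀ r E : ℝ, 0 < r → 0 < E →
      0 < eos.temperature r E ∧ r * eos.e r (eos.temperature r E) = E)
    (hsupp : ∀ z, ∀ᵐ w ∂(Y z), w ∈ phaseQuadrant) {τ : ℝ} {C : ℝ≥0∞} (hC : C < ∞)
    (hτ : ∫⁻ x, ∫⁻ w, ENNReal.ofReal (momentFun eos.toConservative w) ∂(Y (τ, x)) ≤ C) :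
    ∀ᵐ x ∂(volume : Measure (UnitAddTorus (Fin 3))),
      ∫⁻ w, ENNReal.ofReal (momentFun eos.toConservative w) ∂(Y (τ, x)) < ∞ := by
  have hmeas : Measurable fun x : UnitAddTorus (Fin 3) =>
      ∫⁻ w, ENNReal.ofReal (momentFun' eos w) ∂(Y (τ, x)) :=
    (((measurable_momentFun' hG hS htemp).ennreal_ofReal).lintegral_kernel (κ := Y)).comp
      measurable_prodMk_left
  have h := ae_lt_top hmeas (ne_of_lt (lt_of_le_of_lt (le_of_eq_of_le
    (lintegral_congr fun x => lintegral_momentFun'_eq (hsupp (τ, x))) hτ) hC))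
  filter_upwards [h] with x hx
  rwa [lintegral_momentFun'_eq (hsupp (τ, x))] at hx

/-! ## Integrability of integrands built from the point data -/

section PointIntegrands

variable {T₁ : ℝ} {ρ : ℝ → UnitAddTorus (Fin 3) → ℝ}
  {u : ℝ → UnitAddTorus (Fin 3) → EuclideanSpace ℝ (Fin 3)} {ϑ : ℝ → UnitAddTorus (Fin 3) → ℝ}

/-- **Slice integrability.** At a time `τ ∈ (0,T₁)` where the slice moment bound `≤ C < ∞` holds,
an integrand `g` continuous on the good set and dominated by `A·momentFun + B` on the quadrant is
`Y(τ,x)`-integrable for a.e. `x`, and `x ↦ ⟨Y_{τ,x}; g⟩` is integrable with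
`∫⁻ ‖⟨Y_{τ,x}; g⟩‖ₑ dx ≤ A C + B`. [folklore] -/
theorem slice_integrable (hG : eos.IsGibbs) (hS : eos.IsThermodynamicallyStable)
    (htemp : ∀ r E : ℝ, 0 < r → 0 < E →
      0 < eos.temperature r E ∧ r * eos.e r (eos.temperature r E) = E)
    [IsMarkovKernel Y] (hsupp : ∀ z, ∀ᵐ w ∂(Y z), w ∈ phaseQuadrant) {τ : ℝ} (hτ : τ ∈ Ioo 0 T₁)
    {C : ℝ≥0∞} (hC : C < ∞)
    (hmom : ∫⁻ x, ∫⁻ w, ENNReal.ofReal (momentFun eos.toConservative w) ∂(Y (τ, x)) ≤ C)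
    {g : (ℝ × UnitAddTorus (Fin 3)) × EulerPhase → ℝ} (hg : ContinuousOn g (goodSet T₁))
    {A B : ℝ} (hA : 0 ≤ A) (hB : 0 ≤ B)
    (hdom : ∀ x, ∀ w ∈ phaseQuadrant, |g ((τ, x), w)| ≤ A * momentFun eos.toConservative w + B) :
    (∀ᵐ x ∂(volume : Measure (UnitAddTorus (Fin 3))), Integrable (fun w => g ((τ, x), w)) (Y (τ, x))) ∧
    Integrable (fun x => ∫ w, g ((τ, x), w) ∂(Y (τ, x))) volume ∧
    ∫⁻ x, ‖∫ w, g ((τ, x), w) ∂(Y (τ, x))‖ₑ ∂(volume : Measure (UnitAddTorus (Fin 3))) ≤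
      ENNReal.ofReal A * C + ENNReal.ofReal B := by
  classical
  have hκ : ∀ x, ∀ᵐ w ∂(sliceKernel Y τ x), w ∈ phaseQuadrant := fun x => hsupp (τ, x)
  have hg' : Measurable (uncurry fun (x : UnitAddTorus (Fin 3)) (w : EulerPhase) =>
      (goodSet T₁).piecewise g 0 ((τ, x), w)) :=
    (measurable_modify hg).comp ((measurable_const.prodMk measurable_fst).prodMk measurable_snd)
  have hgg : ∀ᵐ x ∂(volume : Measure (UnitAddTorus (Fin 3))), ∀ w ∈ phaseQuadrant,
      g ((τ, x), w) = (goodSet T₁).piecewise g 0 ((τ, x), w) :=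
    Eventually.of_forall fun x w hw => by
      have hmem : ((τ, x), w) ∈ goodSet T₁ := ⟨⟨hτ, mem_univ _⟩, hw⟩
      simp [Set.piecewise, hmem]
  have hdom' : ∀ᵐ x ∂(volume : Measure (UnitAddTorus (Fin 3))), ∀ w ∈ phaseQuadrant,
      |g ((τ, x), w)| ≤ A * momentFun eos.toConservative w + B := Eventually.of_forall hdom
  have hCne : ∫⁻ x, ∫⁻ w, ENNReal.ofReal (momentFun eos.toConservative w) ∂(sliceKernel Y τ x)
      ∂(volume : Measure (UnitAddTorus (Fin 3))) ≠ ∞ :=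
    ne_of_lt (lt_of_le_of_lt hmom hC)
  obtain ⟨h1, h2, h3⟩ := integrable_avg_of_dominated (μ := volume) (κ := sliceKernel Y τ) hκ hg' hgg
    (measurable_momentFun' hG hS htemp) (fun w hw => momentFun'_eq hw) hA hB hdom' hCne
  refine ⟨h1, h2, h3.trans ?_⟩
  simp only [sliceKernel_apply, measure_univ, mul_one]
  gcongr

/-- The space–time region `(0,T) × 𝕋³` has finite measure. [folklore] -/
theorem isFiniteMeasure_restrict_spacetime (T : ℝ) :
    IsFiniteMeasure ((volume : Measure (ℝ × UnitAddTorus (Fin 3))).restrict (Ioo 0 T ×ˢ univ)) := by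
  refine ⟨?_⟩
  rw [Measure.restrict_apply_univ, Measure.volume_eq_prod, Measure.prod_prod]
  exact ENNReal.mul_lt_top measure_Ioo_lt_top (measure_lt_top _ _)

/-- **Space–time integrability** on `(0,T) × 𝕋³`, `T ≤ T₁`: an integrand continuous on the good
set and dominated by `A·momentFun + B` on the quadrant is `Y_z`-integrable for a.e. `z`, and
`z ↦ ⟨Y_z; g⟩` is integrable on `(0,T) × 𝕋³`. [folklore] -/
theorem spacetime_integrable (hG : eos.IsGibbs) (hS : eos.IsThermodynamicallyStable)
    (htemp : ∀ r E : ℝ, 0 < r → 0 < E →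
      0 < eos.temperature r E ∧ r * eos.e r (eos.temperature r E) = E)
    (hMV : IsDissipativeMVSolution eos.toConservative T Y D)
    (hsupp : ∀ z, ∀ᵐ w ∂(Y z), w ∈ phaseQuadrant) (hTT₁ : T ≤ T₁)
    {g : (ℝ × UnitAddTorus (Fin 3)) × EulerPhase → ℝ} (hg : ContinuousOn g (goodSet T₁))
    {A B : ℝ} (hA : 0 ≤ A) (hB : 0 ≤ B)
    (hdom : ∀ z ∈ Ioo (0 : ℝ) T ×ˢ (univ : Set (UnitAddTorus (Fin 3))), ∀ w ∈ phaseQuadrant,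
      |g (z, w)| ≤ A * momentFun eos.toConservative w + B) :
    (∀ᵐ z ∂((volume : Measure (ℝ × UnitAddTorus (Fin 3))).restrict (Ioo 0 T ×ˢ univ)),
      Integrable (fun w => g (z, w)) (Y z)) ∧
    Integrable (fun z => ∫ w, g (z, w) ∂(Y z))
      ((volume : Measure (ℝ × UnitAddTorus (Fin 3))).restrict (Ioo 0 T ×ˢ univ)) := by
  classical
  haveI := hMV.markov
  haveI := isFiniteMeasure_restrict_spacetime T
  set μ := (volume : Measure (ℝ × UnitAddTorus (Fin 3))).restrict (Ioo 0 T ×ˢ univ) with hμ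
  have hmemS : ∀ᵐ z ∂μ, z ∈ Ioo (0 : ℝ) T ×ˢ (univ : Set (UnitAddTorus (Fin 3))) :=
    ae_restrict_mem (measurableSet_Ioo.prod MeasurableSet.univ)
  have hsub : Ioo (0 : ℝ) T ×ˢ (univ : Set (UnitAddTorus (Fin 3))) ⊆ Ioo 0 T₁ ×ˢ univ :=
    prod_mono (Ioo_subset_Ioo_right hTT₁) subset_rfl
  have hg' : Measurable (uncurry fun (z : ℝ × UnitAddTorus (Fin 3)) (w : EulerPhase) =>
      (goodSet T₁).piecewise g 0 (z, w)) := by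
    have : (uncurry fun (z : ℝ × UnitAddTorus (Fin 3)) (w : EulerPhase) =>
        (goodSet T₁).piecewise g 0 (z, w)) = (goodSet T₁).piecewise g 0 := by
      funext q; rfl
    rw [this]; exact measurable_modify hg
  have hgg : ∀ᵐ z ∂μ, ∀ w ∈ phaseQuadrant, g (z, w) = (goodSet T₁).piecewise g 0 (z, w) := by
    filter_upwards [hmemS] with z hz w hw
    have hmem : (z, w) ∈ goodSet T₁ := ⟨hsub hz, hw⟩
    simp [Set.piecewise, hmem]
  have hdom' : ∀ᵐ z ∂μ, ∀ w ∈ phaseQuadrant, |g (z, w)| ≤ A * momentFun eos.toConservative w + B := by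
    filter_upwards [hmemS] with z hz w hw
    exact hdom z hz w hw
  -- finiteness of the space–time moment
  obtain ⟨C, hC, hbound⟩ := hMV.moment_bound
  have hGm : Measurable fun z => ∫⁻ w, ENNReal.ofReal (momentFun' eos w) ∂(Y z) :=
    ((measurable_momentFun' hG hS htemp).ennreal_ofReal).lintegral_kernel
  have hCne : ∫⁻ z, ∫⁻ w, ENNReal.ofReal (momentFun eos.toConservative w) ∂(Y z) ∂μ ≠ ∞ := by
    have e1 : ∫⁻ z, ∫⁻ w, ENNReal.ofReal (momentFun eos.toConservative w) ∂(Y z) ∂μ =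
        ∫⁻ z, ∫⁻ w, ENNReal.ofReal (momentFun' eos w) ∂(Y z) ∂μ :=
      lintegral_congr fun z => (lintegral_momentFun'_eq (hsupp z)).symm
    rw [e1, hμ, Measure.volume_eq_prod, ← Measure.restrict_prod_eq_prod_univ,
      lintegral_prod _ hGm.aemeasurable]
    have e2 : ∀ᵐ τ ∂(volume.restrict (Ioo (0 : ℝ) T)),
        ∫⁻ x, ∫⁻ w, ENNReal.ofReal (momentFun' eos w) ∂(Y (τ, x)) ≤ C := by
      filter_upwards [hbound] with τ hτ
      refine le_of_eq_of_le ?_ hτ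
      exact lintegral_congr fun x => lintegral_momentFun'_eq (hsupp (τ, x))
    refine ne_of_lt (lt_of_le_of_lt (lintegral_mono_ae e2) ?_)
    rw [lintegral_const, Measure.restrict_apply_univ]
    exact ENNReal.mul_lt_top hC measure_Ioo_lt_top
  obtain ⟨h1, h2, -⟩ := integrable_avg_of_dominated (μ := μ) (κ := Y) hsupp hg' hgg
    (measurable_momentFun' hG hS htemp) (fun w hw => momentFun'_eq hw) hA hB hdom' hCne
  exact ⟨h1, h2⟩

end PointIntegrands

end CompressibleEuler

end Literature.Analysis.FluidPDE
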